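import Literature.ModelTheory.ExponentialFields.SemialgebraicGenericSmooth
import Literature.ModelTheory.ExponentialFields.SemialgebraicPartialDeriv
import HarnessLib

/-!
# The `C¹`-extension theorem at a flat boundary piece (Pawłucki's Theorem 5.3, `p = 1`)

Topic `Literature/ModelTheory/ExponentialFields` — block B4₃ of the proof of the
`C¹`-triangulation theorem for compact semialgebraic sets
(`Literature.ModelTheory.ExponentialFields.OhmotoShiota2017_c1Triangulation`, statement of
[OhmotoShiota2017, Thm. 1.1]) along the proof of [Pawlucki2024], specialized to `p = 1`.

**[Pawlucki2024, Thm. 5.3]** ([Pawlucki1985, Prop. 2]) in straightened form: let `f` be a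
semialgebraic `C¹` function on the half-box `S = G × (0, η)` (`G ⊆ ℝᵐ` open semialgebraic) whose
normal derivative `∂f/∂t` is bounded.  Then off a closed small (nowhere dense) semialgebraic
`Z ⊆ ℝᵐ`, `f` extends to a `C¹` function on `(G ∖ Z) × [0, η)`.  Proof as printed: the limit
`g(a) = lim_{t→0⁺} f(a, t)` exists (bounded `∂f/∂t`) and is semialgebraic, hence `C¹` off a small
set; replacing `f` by `f - g` one may assume `g = 0`, and then `|f(a, t)| ≤ M t`; the normal
derivative has a limit at generic bottom points (cluster sets are intervals; dimension count —
block B4₀); the tangential derivatives have `0` as a limit value everywhere (mean value theorem)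
hence tend to `0` generically (same dimension count); the extension is `C¹` up to the bottom by the
mean value inequality (`hasFDerivWithinAt_closure_of_tendsto_fderiv`).

No named facts are introduced (D-0026).

## References

* [Pawlucki2024] W. Pawłucki, *Strict `C^p`-triangulations — a new approach to
  desingularization*, J. Eur. Math. Soc. 26 (2024), 3863–3909, Thm. 5.3 and its proof.
* [Dries1998] L. van den Dries, *Tame topology and o-minimal structures*, Ch. 4 (1.8), Ch. 7 (3.2).
* [OhmotoShiota2017] T. Ohmoto, M. Shiota, *`C¹`-triangulations of semialgebraic sets*,
  J. Topology 10 (2017), Thm. 1.1 (statement only).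
-/

noncomputable section

open Set Filter Metric
open _root_.Topology

namespace Literature.ModelTheory.ExponentialFields

open Literature.NumberTheory.Transcendental (IsSemialgebraicFunOn IsSemialgebraicMapOn
  isSemialgebraicFunOn_iff)

section Boundary

variable {m : ℕ}

/-! ### Slices of the half-box -/

/-- `snoc a t` as an update of `snoc a s` in the last coordinate. [folklore] -/
theorem snoc_eq_update_last (a : Fin m → ℝ) (s t : ℝ) :
    (Fin.snoc a t : Fin (m + 1) → ℝ) = Function.update (Fin.snoc a s) (Fin.last m) t := by
  ext i
  refine Fin.lastCases ?_ (fun j => ?_) i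
  · simp
  · rw [Function.update_of_ne (Fin.castSucc_lt_last j).ne]; simp

/-- `snoc (update a j s) t = update (snoc a t) (castSucc j) s`. [folklore] -/
theorem snoc_update (a : Fin m → ℝ) (j : Fin m) (s t : ℝ) :
    (Fin.snoc (Function.update a j s) t : Fin (m + 1) → ℝ) = Function.update (Fin.snoc a t) j.castSucc s := by
  ext i
  refine Fin.lastCases ?_ (fun l => ?_) i
  · rw [Fin.snoc_last, Function.update_of_ne (Fin.castSucc_lt_last j).ne']; simp
  · rw [Fin.snoc_castSucc]
    by_cases h : l = j
    · subst h; simp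
    · rw [Function.update_of_ne h, Function.update_of_ne (fun h' => h (Fin.castSucc_injective _ h'))]; simp

/-- The normal slice `t ↦ f (a, t)` has derivative `∂_t f`. [cite: Pawlucki2024, Thm. 5.3 (proof)] -/
theorem hasDerivAt_normal_slice {f : (Fin (m + 1) → ℝ) → ℝ} {a : Fin m → ℝ} {t : ℝ}
    (hf : DifferentiableAt ℝ f (Fin.snoc a t)) :
    HasDerivAt (fun s => f (Fin.snoc a s)) (partialDeriv f (Fin.last m) (Fin.snoc a t)) t := by
  have h := hasDerivAt_slice hf (Fin.last m)
  simp only [Fin.snoc_last] at h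
  have heq : (fun s => f (Function.update (Fin.snoc a t : Fin (m + 1) → ℝ) (Fin.last m) s)) = fun s => f (Fin.snoc a s) := by
    funext s; rw [← snoc_eq_update_last]
  rwa [heq] at h

/-- The tangential slice `s ↦ f (update a j s, t)` has derivative `∂_j f`. [cite: Pawlucki2024, Thm. 5.3 (proof)] -/
theorem hasDerivAt_tangential_slice {f : (Fin (m + 1) → ℝ) → ℝ} {a : Fin m → ℝ} {t : ℝ}
    (hf : DifferentiableAt ℝ f (Fin.snoc a t)) (j : Fin m) :
    HasDerivAt (fun s => f (Fin.snoc (Function.update a j s) t)) (partialDeriv f j.castSucc (Fin.snoc a t)) (a j) := by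
  have h := hasDerivAt_slice hf j.castSucc
  simp only [Fin.snoc_castSucc] at h
  have heq : (fun s => f (Function.update (Fin.snoc a t : Fin (m + 1) → ℝ) j.castSucc s)) =
      fun s => f (Fin.snoc (Function.update a j s) t) := by
    funext s; rw [snoc_update]
  rwa [heq] at h

/-! ### The limit at the bottom (bounded normal derivative) -/

variable {G : Set (Fin m → ℝ)} {η : ℝ} {f : (Fin (m + 1) → ℝ) → ℝ} {M : ℝ}

/-- The half-box over an open base is open. [cite: Pawlucki2024, Thm. 5.3] -/
theorem isOpen_halfBox (hG : IsOpen G) (η : ℝ) : IsOpen (halfBox G η) := by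
  have h1 : IsOpen {z : Fin (m + 1) → ℝ | (Fin.init z : Fin m → ℝ) ∈ G} :=
    hG.preimage (continuous_pi fun i => continuous_apply _)
  exact h1.inter ((isOpen_lt continuous_const (continuous_apply _)).inter
    (isOpen_lt (continuous_apply _) continuous_const))

/-- **Lipschitz estimate along the normal slice.** [cite: Pawlucki2024, Thm. 5.3 (proof)] -/
theorem abs_sub_le_of_normal_bound (hG : IsOpen G) (hd : DifferentiableOn ℝ f (halfBox G η))
    (hM : ∀ z ∈ halfBox G η, |partialDeriv f (Fin.last m) z| ≤ M) {a : Fin m → ℝ} (ha : a ∈ G)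
    {s t : ℝ} (hs : s ∈ Ioo 0 η) (ht : t ∈ Ioo 0 η) : |f (Fin.snoc a t) - f (Fin.snoc a s)| ≤ M * |t - s| := by
  have hS := isOpen_halfBox hG η
  have hder : ∀ x ∈ Ioo 0 η, HasDerivWithinAt (fun s => f (Fin.snoc a s))
      (partialDeriv f (Fin.last m) (Fin.snoc a x)) (Ioo 0 η) x := fun x hx =>
    (hasDerivAt_normal_slice ((hd _ (snoc_mem_halfBox.2 ⟨ha, hx.1, hx.2⟩)).differentiableAt
      (hS.mem_nhds (snoc_mem_halfBox.2 ⟨ha, hx.1, hx.2⟩)))).hasDerivWithinAt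
  have h := (convex_Ioo (0 : ℝ) η).norm_image_sub_le_of_norm_hasDerivWithin_le hder
    (fun x hx => by rw [Real.norm_eq_abs]; exact hM _ (snoc_mem_halfBox.2 ⟨ha, hx.1, hx.2⟩)) hs ht
  simpa only [Real.norm_eq_abs] using h

/-- **The limit `g(a) = lim_{t → 0⁺} f(a, t)` exists** (bounded normal derivative), with the uniform
estimate `|f(a, t) - g(a)| ≤ M t`. [cite: Pawlucki2024, Thm. 5.3 (proof, (5.3.1))] -/
theorem exists_tendsto_normal_slice (hG : IsOpen G) (hη : 0 < η) (hd : DifferentiableOn ℝ f (halfBox G η))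
    (hM : ∀ z ∈ halfBox G η, |partialDeriv f (Fin.last m) z| ≤ M) {a : Fin m → ℝ} (ha : a ∈ G) :
    ∃ v : ℝ, Tendsto (fun t => f (Fin.snoc a t)) (𝓝[>] 0) (𝓝 v) ∧ ∀ t ∈ Ioo 0 η, |f (Fin.snoc a t) - v| ≤ M * t := by
  have hS := isOpen_halfBox hG η
  set φ : ℝ → ℝ := fun t => f (Fin.snoc a t) with hφ
  have hmem : ∀ {x}, x ∈ Ioo 0 η → (Fin.snoc a x : Fin (m + 1) → ℝ) ∈ halfBox G η := fun hx =>
    snoc_mem_halfBox.2 ⟨ha, hx.1, hx.2⟩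
  have hder : ∀ x ∈ Ioo 0 η, HasDerivAt φ (partialDeriv f (Fin.last m) (Fin.snoc a x)) x := fun x hx =>
    hasDerivAt_normal_slice ((hd _ (hmem hx)).differentiableAt (hS.mem_nhds (hmem hx)))
  have hM0 : 0 ≤ M := (abs_nonneg _).trans (hM _ (hmem ⟨half_pos hη, half_lt_self hη⟩))
  -- `ψ = φ + M t` is monotone and bounded below on `(0, η)`
  set ψ : ℝ → ℝ := fun t => φ t + M * t with hψ
  have hψmono : MonotoneOn ψ (Ioo 0 η) := by
    refine monotoneOn_of_deriv_nonneg (convex_Ioo 0 η) ?_ ?_ ?_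
    · exact fun x hx => ((hder x hx).continuousAt.add (continuousAt_const.mul continuousAt_id)).continuousWithinAt
    · rw [interior_Ioo]
      exact fun x hx => ((hder x hx).add ((hasDerivAt_id x).const_mul M)).differentiableAt.differentiableWithinAt
    · rw [interior_Ioo]
      intro x hx
      rw [show deriv ψ x = partialDeriv f (Fin.last m) (Fin.snoc a x) + M * 1 from
        ((hder x hx).add ((hasDerivAt_id x).const_mul M)).deriv]
      have := (abs_le.1 (hM _ (hmem hx))).1
      linarith
  have hlip : ∀ s ∈ Ioo 0 η, ∀ t ∈ Ioo 0 η, |φ t - φ s| ≤ M * |t - s| := fun s hs t ht =>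
    abs_sub_le_of_normal_bound hG hd hM ha hs ht
  have hbdd : BddBelow (ψ '' Ioo 0 η) := by
    refine ⟨φ (η / 2) - M * η, ?_⟩
    rintro _ ⟨s, hs, rfl⟩
    have h := hlip (η / 2) ⟨half_pos hη, half_lt_self hη⟩ s hs
    have h1 := (abs_le.1 h).1
    have h2 : |s - η / 2| ≤ η := by rw [abs_le]; constructor <;> linarith [hs.1, hs.2]
    show φ (η / 2) - M * η ≤ φ s + M * s
    nlinarith [hs.1]
  have hψlim := hψmono.tendsto_nhdsWithin_Ioo_right (nonempty_Ioo.2 hη) hbdd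
  set v := sInf (ψ '' Ioo 0 η) - M * 0 with hv
  have hφlim : Tendsto φ (𝓝[>] 0) (𝓝 v) := by
    have h : Tendsto (fun t => ψ t - M * t) (𝓝[>] 0) (𝓝 (sInf (ψ '' Ioo 0 η) - M * 0)) :=
      hψlim.sub ((continuous_const.mul continuous_id).continuousAt.tendsto.mono_left nhdsWithin_le_nhds)
    have heq : (fun t => ψ t - M * t) = φ := by funext t; simp [hψ]
    rwa [heq] at h
  refine ⟨v, hφlim, fun t ht => ?_⟩
  -- uniform estimate: `|φ t - φ s| ≤ M (t - s) ≤ M t` for `s < t`, let `s → 0⁺`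
  have hev : ∀ᶠ s in 𝓝[>] 0, |φ t - φ s| ≤ M * t := by
    have h1 : ∀ᶠ s in 𝓝[>] 0, s ∈ Ioo 0 t := Ioo_mem_nhdsGT ht.1
    filter_upwards [h1] with s hs
    have h := hlip s ⟨hs.1, hs.2.trans ht.2⟩ t ht
    rw [abs_of_pos (sub_pos.2 hs.2)] at h
    nlinarith [hs.1]
  have hcont : Tendsto (fun s => |φ t - φ s|) (𝓝[>] 0) (𝓝 |φ t - v|) :=
    (continuous_abs.tendsto _).comp (tendsto_const_nhds.sub hφlim)
  exact le_of_tendsto hcont hev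

/-! ### Convergence of derivatives from convergence of partial derivatives -/

/-- Operator-norm convergence of linear forms on `ℝᵏ` from convergence on the coordinate vectors.
[folklore] -/
theorem tendsto_clm_of_tendsto_apply_single {k : ℕ} {α : Type*} {l : Filter α}
    {A : α → (Fin k → ℝ) →L[ℝ] ℝ} {B : (Fin k → ℝ) →L[ℝ] ℝ}
    (h : ∀ i, Tendsto (fun x => A x (Pi.single i 1)) l (𝓝 (B (Pi.single i 1)))) : Tendsto A l (𝓝 B) := by
  rw [Metric.tendsto_nhds]
  intro ε hε
  have hk : ∀ i, ∀ᶠ x in l, |A x (Pi.single i 1) - B (Pi.single i 1)| < ε / (k + 1) := fun i => by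
    have := Metric.tendsto_nhds.1 (h i) (ε / (k + 1)) (div_pos hε (Nat.cast_add_one_pos k))
    filter_upwards [this] with x hx
    rwa [Real.dist_eq] at hx
  have hall := Filter.eventually_all.2 hk
  filter_upwards [hall] with x hx
  rw [dist_eq_norm]
  have hbound : ‖A x - B‖ ≤ k * (ε / (k + 1)) := by
    refine ContinuousLinearMap.opNorm_le_bound _ (by positivity) fun v => ?_
    have hv : v = ∑ i, v i • (Pi.single i (1 : ℝ) : Fin k → ℝ) := by
      ext j; simp [Finset.sum_apply, Pi.single_apply]
    calc ‖(A x - B) v‖ = ‖∑ i, v i * (A x (Pi.single i 1) - B (Pi.single i 1))‖ := by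
            conv_lhs => rw [hv]
            simp [map_sum]
      _ ≤ ∑ i, ‖v i * (A x (Pi.single i 1) - B (Pi.single i 1))‖ := norm_sum_le _ _
      _ ≤ ∑ i : Fin k, ‖v‖ * (ε / (k + 1)) := Finset.sum_le_sum fun i _ => by
            rw [norm_mul]
            exact mul_le_mul (norm_le_pi_norm v i) (le_of_lt (by simpa [Real.norm_eq_abs] using hx i))
              (norm_nonneg _) (norm_nonneg _)
      _ = k * (ε / (k + 1)) * ‖v‖ := by rw [Finset.sum_const, Finset.card_univ, Fintype.card_fin]; ring
  have hlt : (k : ℝ) * (ε / (k + 1)) < ε := by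
    rw [← mul_div_assoc, div_lt_iff₀ (Nat.cast_add_one_pos k)]; nlinarith
  exact hbound.trans_lt hlt

/-! ### Tangential derivatives have `0` as a limit value (mean value theorem) -/

/-- **`0 ∈ Lim ∂ⱼ f`** at every bottom point when `|f(x, t)| ≤ M t`: the mean value theorem on
horizontal segments. [cite: Pawlucki2024, Thm. 5.3 (proof, (5.3.2))] -/
theorem zero_mem_clusterSet_tangential (hG : IsOpen G) (hη : 0 < η) (hd : DifferentiableOn ℝ f (halfBox G η))
    (hest : ∀ x ∈ G, ∀ t ∈ Ioo 0 η, |f (Fin.snoc x t)| ≤ M * t) (j : Fin m) {a : Fin m → ℝ} (ha : a ∈ G) :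
    (0 : ℝ) ∈ clusterSet (partialDeriv f j.castSucc) (halfBox G η) (Fin.snoc a 0) := by
  have hS := isOpen_halfBox hG η
  intro ε hε δ hδ
  -- a cube around `a` inside `G`, of radius `ρ < δ`
  obtain ⟨ρ₀, hρ₀, hball⟩ := Metric.isOpen_iff.1 hG a ha
  set ρ := min (ρ₀ / 2) (δ / 2) with hρ
  have hρpos : 0 < ρ := lt_min (half_pos hρ₀) (half_pos hδ)
  have hρδ : ρ < δ := (min_le_right _ _).trans_lt (half_lt_self hδ)
  have hM0 : 0 ≤ M := by
    have h := hest a ha (η / 2) ⟨half_pos hη, half_lt_self hη⟩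
    exact nonneg_of_mul_nonneg_left ((abs_nonneg _).trans h) (half_pos hη)
  -- a small height `t`
  set t := min (η / 2) (min (δ / 2) (ε * ρ / (M + 1))) with ht
  have hM1 : 0 < M + 1 := by linarith
  have htpos : 0 < t := lt_min (half_pos hη) (lt_min (half_pos hδ) (div_pos (mul_pos hε hρpos) hM1))
  have htη : t ∈ Ioo 0 η := ⟨htpos, (min_le_left _ _).trans_lt (half_lt_self hη)⟩
  have htδ : t < δ := (min_le_right _ _).trans_lt ((min_le_left _ _).trans_lt (half_lt_self hδ))
  have htε : M * t < ε * ρ := by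
    have h1 : t ≤ ε * ρ / (M + 1) := (min_le_right _ _).trans (min_le_right _ _)
    have h2 : (M + 1) * t ≤ ε * ρ := by rw [le_div_iff₀ hM1] at h1; linarith
    nlinarith
  -- points of the horizontal segment lie in `G`
  have hupd : ∀ s ∈ Icc (a j - ρ) (a j + ρ), Function.update a j s ∈ G := by
    intro s hs
    refine hball (mem_ball.2 ?_)
    rw [dist_comm, dist_eq_norm, pi_norm_lt_iff hρ₀]
    intro i
    by_cases hi : i = j
    · subst hi
      simp only [Pi.sub_apply, Function.update_self, Real.norm_eq_abs]
      have : |a i - s| ≤ ρ := by rw [abs_le]; constructor <;> linarith [hs.1, hs.2]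
      exact this.trans_lt ((min_le_left _ _).trans_lt (half_lt_self hρ₀))
    · simp [Function.update_of_ne hi, hρ₀]
  -- the mean value theorem on `s ↦ f (update a j s, t)` over `[a j - ρ, a j + ρ]`
  set F : ℝ → ℝ := fun s => f (Fin.snoc (Function.update a j s) t) with hF
  have hderF : ∀ s ∈ Icc (a j - ρ) (a j + ρ), HasDerivAt F (partialDeriv f j.castSucc (Fin.snoc (Function.update a j s) t)) s := by
    intro s hs
    have hmem : (Fin.snoc (Function.update a j s) t : Fin (m + 1) → ℝ) ∈ halfBox G η :=
      snoc_mem_halfBox.2 ⟨hupd s hs, htη.1, htη.2⟩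
    have h := hasDerivAt_tangential_slice ((hd _ hmem).differentiableAt (hS.mem_nhds hmem)) j
    simp only [Function.update_self, Function.update_idem] at h
    exact h
  have hab : a j - ρ < a j + ρ := by linarith
  obtain ⟨c, hc, hcslope⟩ := exists_hasDerivAt_eq_slope F (fun s => partialDeriv f j.castSucc (Fin.snoc (Function.update a j s) t))
    hab (fun s hs => (hderF s hs).continuousAt.continuousWithinAt) (fun s hs => hderF s ⟨hs.1.le, hs.2.le⟩)
  refine ⟨Fin.snoc (Function.update a j c) t, snoc_mem_halfBox.2 ⟨hupd c ⟨hc.1.le, hc.2.le⟩, htη.1, htη.2⟩, ?_, ?_⟩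
  · rw [dist_snoc_snoc_max]
    refine max_lt ?_ (by rw [Real.dist_eq, sub_zero, abs_of_pos htpos]; exact htδ)
    rw [dist_eq_norm, pi_norm_lt_iff hδ]
    intro i
    by_cases hi : i = j
    · subst hi
      simp only [Pi.sub_apply, Function.update_self, Real.norm_eq_abs]
      have : |c - a i| < ρ := by rw [abs_lt]; constructor <;> linarith [hc.1, hc.2]
      exact this.trans hρδ
    · simp [Function.update_of_ne hi, hδ]
  · rw [hcslope, Real.dist_eq, sub_zero]
    have h1 := hest _ (hupd _ (right_mem_Icc.2 hab.le)) t htη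
    have h2 := hest _ (hupd _ (left_mem_Icc.2 hab.le)) t htη
    have hden : a j + ρ - (a j - ρ) = 2 * ρ := by ring
    rw [hden, abs_div, abs_of_pos (by linarith : (0 : ℝ) < 2 * ρ)]
    rw [div_lt_iff₀ (by linarith : (0 : ℝ) < 2 * ρ)]
    calc |F (a j + ρ) - F (a j - ρ)| ≤ |F (a j + ρ)| + |F (a j - ρ)| := abs_sub _ _
      _ ≤ M * t + M * t := add_le_add h1 h2
      _ < ε * (2 * ρ) := by linarith

/-! ### Small bookkeeping -/

/-- Finite unions of small semialgebraic sets are small. [cite: Dries1998, Ch. 4 (1.8)] -/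
theorem isSmall_biUnion {ι : Type*} (s : Finset ι) {Z : ι → Set (Fin m → ℝ)} (hZ : ∀ i ∈ s, IsSmall (Z i))
    (hZs : ∀ i ∈ s, IsSemialgebraic ℝ (Z i)) : IsSmall (⋃ i ∈ s, Z i) := by
  classical
  induction s using Finset.induction_on with
  | empty => simp [isSmall_empty]
  | insert a s ha ih =>
    rw [Finset.set_biUnion_insert]
    exact (hZ a (Finset.mem_insert_self a s)).union (ih (fun i hi => hZ i (Finset.mem_insert_of_mem hi))
      fun i hi => hZs i (Finset.mem_insert_of_mem hi)) (hZs a (Finset.mem_insert_self a s))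
      (IsSemialgebraic.biUnion _ _ fun i hi => hZs i (Finset.mem_insert_of_mem hi))

/-! ### Linear algebra of `init` and the last coordinate -/

/-- `Fin.init` as a continuous linear map. [folklore] -/
def initL (m : ℕ) : (Fin (m + 1) → ℝ) →L[ℝ] (Fin m → ℝ) :=
  ContinuousLinearMap.pi fun i : Fin m => ContinuousLinearMap.proj (R := ℝ) (φ := fun _ : Fin (m + 1) => ℝ) i.castSucc

/-- `initL v = init v`. [folklore] -/
@[simp] theorem initL_apply (v : Fin (m + 1) → ℝ) : initL m v = Fin.init v := rfl

/-- The last-coordinate projection. [folklore] -/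
def projL (m : ℕ) : (Fin (m + 1) → ℝ) →L[ℝ] ℝ := ContinuousLinearMap.proj (R := ℝ) (φ := fun _ : Fin (m + 1) => ℝ) (Fin.last m)

/-- `projL v = v last`. [folklore] -/
@[simp] theorem projL_apply (v : Fin (m + 1) → ℝ) : projL m v = v (Fin.last m) := rfl

/-- `init (e_last) = 0`. [folklore] -/
@[simp] theorem init_single_last : Fin.init (Pi.single (Fin.last m) (1 : ℝ) : Fin (m + 1) → ℝ) = 0 := by
  funext i; simp [Fin.init, (Fin.castSucc_lt_last i).ne]

/-- `init (e_{castSucc j}) = e_j`. [folklore] -/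
@[simp] theorem init_single_castSucc (j : Fin m) :
    Fin.init (Pi.single j.castSucc (1 : ℝ) : Fin (m + 1) → ℝ) = Pi.single j 1 := by
  funext i; simp [Fin.init, Pi.single_apply, Fin.castSucc_inj]

/-- `Fin.init` is smooth. [folklore] -/
theorem contDiff_init' : ContDiff ℝ 1 (Fin.init : (Fin (m + 1) → ℝ) → (Fin m → ℝ)) := (initL m).contDiff

/-- A vector with last coordinate `0` is `snoc (init z) 0`. [folklore] -/
theorem eq_snoc_init_of_last_eq_zero {z : Fin (m + 1) → ℝ} (hz : z (Fin.last m) = 0) : z = Fin.snoc (Fin.init z) 0 := by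
  conv_lhs => rw [← Fin.snoc_init_self z, hz]

/-! ### The closed half-box and its unique differentiability -/

/-- The closed half-box `G × [0, η)`. [cite: Pawlucki2024, Thm. 5.3] -/
def closedHalfBox (G : Set (Fin m → ℝ)) (η : ℝ) : Set (Fin (m + 1) → ℝ) :=
  {z | Fin.init z ∈ G ∧ 0 ≤ z (Fin.last m) ∧ z (Fin.last m) < η}

/-- Membership of `snoc`. [cite: Pawlucki2024, Thm. 5.3] -/
@[simp] theorem snoc_mem_closedHalfBox {x : Fin m → ℝ} {t : ℝ} :
    (Fin.snoc x t : Fin (m + 1) → ℝ) ∈ closedHalfBox G η ↔ x ∈ G ∧ 0 ≤ t ∧ t < η := by simp [closedHalfBox]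

/-- The open half-box is contained in the closed one. [cite: Pawlucki2024, Thm. 5.3] -/
theorem halfBox_subset_closedHalfBox : halfBox G η ⊆ closedHalfBox G η := fun _ hz => ⟨hz.1, hz.2.1.le, hz.2.2⟩

/-- Closed half-boxes over convex bases are convex. [folklore] -/
theorem convex_closedHalfBox {B : Set (Fin m → ℝ)} (hB : Convex ℝ B) (η : ℝ) : Convex ℝ (closedHalfBox B η) := by
  have h : closedHalfBox B η = initL m ⁻¹' B ∩ ({z | 0 ≤ z (Fin.last m)} ∩ {z | z (Fin.last m) < η}) := by
    ext z; simp [closedHalfBox]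
  rw [h]
  have hlast : IsLinearMap ℝ fun z : Fin (m + 1) → ℝ => z (Fin.last m) := ⟨fun _ _ => rfl, fun _ _ => rfl⟩
  exact (hB.linear_preimage _).inter ((convex_halfSpace_ge hlast 0).inter (convex_halfSpace_lt hlast η))

/-- **Unique differentiability on the closed half-box over an open base.** [folklore] -/
theorem uniqueDiffOn_closedHalfBox (hG : IsOpen G) (hη : 0 < η) : UniqueDiffOn ℝ (closedHalfBox G η) := by
  intro z hz
  obtain ⟨ρ, hρ, hball⟩ := Metric.isOpen_iff.1 hG _ hz.1
  have hK : UniqueDiffOn ℝ (closedHalfBox (ball (Fin.init z) ρ) η) := by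
    refine uniqueDiffOn_convex (convex_closedHalfBox (convex_ball _ _) η) ?_
    refine ⟨Fin.snoc (Fin.init z) (η / 2), mem_interior_iff_mem_nhds.2 ?_⟩
    have ho : IsOpen (halfBox (ball (Fin.init z) ρ) η) := isOpen_halfBox isOpen_ball η
    exact mem_of_superset (ho.mem_nhds (snoc_mem_halfBox.2 ⟨mem_ball_self hρ, half_pos hη, half_lt_self hη⟩))
      halfBox_subset_closedHalfBox
  exact (hK z ⟨mem_ball_self hρ, hz.2⟩).mono fun w hw => ⟨hball hw.1, hw.2⟩

/-! ### The extension -/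

/-- The extension of `f` by `g` at the bottom. [cite: Pawlucki2024, Thm. 5.3] -/
def bdExt (f : (Fin (m + 1) → ℝ) → ℝ) (g : (Fin m → ℝ) → ℝ) (z : Fin (m + 1) → ℝ) : ℝ :=
  if 0 < z (Fin.last m) then f z else g (Fin.init z)

/-- The half-box over a smaller base is a relatively open part: `𝓝[halfBox G' η] = 𝓝[halfBox G η]` at
bottom points of an open `G' ⊆ G`. [folklore] -/
theorem nhdsWithin_halfBox_eq {G' : Set (Fin m → ℝ)} (hG' : IsOpen G') (hG'G : G' ⊆ G) {a : Fin m → ℝ} (ha : a ∈ G')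
    (t : ℝ) : nhdsWithin (Fin.snoc a t : Fin (m + 1) → ℝ) (halfBox G' η) = nhdsWithin (Fin.snoc a t : Fin (m + 1) → ℝ) (halfBox G η) := by
  have h : halfBox G' η = halfBox G η ∩ {z | (Fin.init z : Fin m → ℝ) ∈ G'} := by
    ext z; simp only [halfBox, mem_setOf_eq, mem_inter_iff]
    exact ⟨fun ⟨h1, h2⟩ => ⟨⟨hG'G h1, h2⟩, h1⟩, fun ⟨⟨_, h2⟩, h1⟩ => ⟨h1, h2⟩⟩
  rw [h]
  have hc : Continuous fun z : Fin (m + 1) → ℝ => (Fin.init z : Fin m → ℝ) := continuous_pi fun i => continuous_apply _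
  have hmem : {z : Fin (m + 1) → ℝ | (Fin.init z : Fin m → ℝ) ∈ G'} ∈ 𝓝 (Fin.snoc a t : Fin (m + 1) → ℝ) := by
    refine (hG'.preimage hc).mem_nhds ?_
    show (Fin.init (Fin.snoc a t : Fin (m + 1) → ℝ) : Fin m → ℝ) ∈ G'
    rw [Fin.init_snoc]; exact ha
  rw [inter_comm]; exact nhdsWithin_inter_of_mem (mem_nhdsWithin_of_mem_nhds hmem)

/-- **[Pawlucki2024, Thm. 5.3] (`C¹`-extension theorem, `p = 1`, straightened form).** A
semialgebraic `C¹` function on the half-box `G × (0, η)` with bounded normal derivative extends, off a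
closed small (nowhere dense) semialgebraic subset `Z` of the base, to a `C¹` function on
`(G ∖ Z) × [0, η)`; the boundary value `g` is `C¹` on `G ∖ Z`, the normal derivative has the
continuous limit `λ`, and the derivative of the extension at `(a, 0)` is `D(g ∘ init) + λ(a) dt`.
[cite: Pawlucki2024, Thm. 5.3] -/
theorem c1_extension_halfBox (hG : IsOpen G) (hGs : IsSemialgebraic ℝ G) (hη : 0 < η)
    (hf : ContDiffOn ℝ 1 f (halfBox G η)) (hfs : IsSemialgebraicFunOn ℝ (halfBox G η) f)
    (hM : ∀ z ∈ halfBox G η, |partialDeriv f (Fin.last m) z| ≤ M) :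
    ∃ (Z : Set (Fin m → ℝ)) (g lam : (Fin m → ℝ) → ℝ),
      IsSemialgebraic ℝ Z ∧ IsClosed Z ∧ IsSmall Z ∧ IsSemialgebraicFunOn ℝ G g ∧
      ContDiffOn ℝ 1 g (G \ Z) ∧ ContinuousOn lam (G \ Z) ∧
      (∀ a ∈ G \ Z, Tendsto f (𝓝[halfBox G η] (Fin.snoc a 0)) (𝓝 (g a))) ∧
      (∀ a ∈ G \ Z, Tendsto (partialDeriv f (Fin.last m)) (𝓝[halfBox G η] (Fin.snoc a 0)) (𝓝 (lam a))) ∧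
      ContDiffOn ℝ 1 (bdExt f g) (closedHalfBox (G \ Z) η) ∧
      ∀ a ∈ G \ Z, HasFDerivWithinAt (bdExt f g)
        (fderiv ℝ (fun z : Fin (m + 1) → ℝ => g (Fin.init z)) (Fin.snoc a 0) + lam a • projL m)
        (closedHalfBox (G \ Z) η) (Fin.snoc a 0) := by
  classical
  set L := Fin.last m with hLdef
  set S := halfBox G η with hSdef
  have hSo : IsOpen S := isOpen_halfBox hG η
  have hd : DifferentiableOn ℝ f S := hf.differentiableOn one_ne_zero
  -- Step 1: the limit `g`
  have hlimex : ∀ a ∈ G, ∃ v : ℝ, Tendsto (fun t => f (Fin.snoc a t)) (𝓝[>] 0) (𝓝 v) ∧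
      ∀ t ∈ Ioo 0 η, |f (Fin.snoc a t) - v| ≤ M * t := fun a ha => exists_tendsto_normal_slice hG hη hd hM ha
  choose! g hg_lim hg_est using hlimex
  have hg_sa : IsSemialgebraicFunOn ℝ G g := isSemialgebraicFunOn_lim hGs subset_rfl hη hfs hg_lim
  -- Step 2: `g` is `C¹` off a small set
  obtain ⟨Z₁, hZ₁sa, hZ₁cl, hZ₁sm, hG₁o, hg1⟩ := exists_contDiffOn_off_small hG hg_sa
  set G₁ := G \ Z₁ with hG₁
  have hG₁sa : IsSemialgebraic ℝ G₁ := hGs.diff hZ₁sa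
  have hG₁G : G₁ ⊆ G := fun _ h => h.1
  -- Step 3: `f₁ = f - g ∘ init` on `S₁`
  set S₁ := halfBox G₁ η with hS₁
  have hS₁o : IsOpen S₁ := isOpen_halfBox hG₁o η
  have hS₁sa : IsSemialgebraic ℝ S₁ := isSemialgebraic_halfBox hG₁sa η
  have hS₁S : S₁ ⊆ S := fun z hz => ⟨hG₁G hz.1, hz.2⟩
  set f₁ : (Fin (m + 1) → ℝ) → ℝ := fun z => f z - g (Fin.init z) with hf₁
  have hginit : ContDiffOn ℝ 1 (fun z : Fin (m + 1) → ℝ => g (Fin.init z)) {z | (Fin.init z : Fin m → ℝ) ∈ G₁} :=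
    hg1.comp contDiff_init'.contDiffOn fun z hz => hz
  have hginit_o : IsOpen {z : Fin (m + 1) → ℝ | (Fin.init z : Fin m → ℝ) ∈ G₁} :=
    hG₁o.preimage (continuous_pi fun i => continuous_apply _)
  have hf1 : ContDiffOn ℝ 1 f₁ S₁ := (hf.mono hS₁S).sub (hginit.mono fun z hz => hz.1)
  have hd1 : DifferentiableOn ℝ f₁ S₁ := hf1.differentiableOn one_ne_zero
  have hf1s : IsSemialgebraicFunOn ℝ S₁ f₁ := by
    refine IsSemialgebraicFunOn.sub_holds (hfs.mono hS₁S hS₁sa) ?_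
    exact IsSemialgebraicFunOn.comp_isSemialgebraicMapOn_holds (hg_sa.mono hG₁G hG₁sa)
      ((Literature.NumberTheory.Transcendental.isSemialgebraicMapOn_iff_forall_holds hS₁sa).mpr
        fun j => isSemialgebraicFunOn_apply hS₁sa j.castSucc) fun z hz => hz.1
  -- derivative of `g ∘ init`
  have hDginit : ∀ z : Fin (m + 1) → ℝ, (Fin.init z : Fin m → ℝ) ∈ G₁ →
      HasFDerivAt (fun z : Fin (m + 1) → ℝ => g (Fin.init z)) ((fderiv ℝ g (Fin.init z)).comp (initL m)) z := by
    intro z hz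
    have hg' : HasFDerivAt g (fderiv ℝ g (Fin.init z)) (Fin.init z) :=
      (((hg1.differentiableOn one_ne_zero) _ hz).differentiableAt (hG₁o.mem_nhds hz)).hasFDerivAt
    exact hg'.comp z (initL m).hasFDerivAt
  have hDf1 : ∀ z ∈ S₁, HasFDerivAt f₁ (fderiv ℝ f z - (fderiv ℝ g (Fin.init z)).comp (initL m)) z := by
    intro z hz
    have h1 : HasFDerivAt f (fderiv ℝ f z) z := ((hd z (hS₁S hz)).differentiableAt (hSo.mem_nhds (hS₁S hz))).hasFDerivAt
    exact h1.sub (hDginit z hz.1)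
  have hpd1L : ∀ z ∈ S₁, partialDeriv f₁ L z = partialDeriv f L z := by
    intro z hz
    simp only [partialDeriv]
    rw [(hDf1 z hz).fderiv]
    simp [hLdef]
  have hpd1j : ∀ z ∈ S₁, ∀ j : Fin m, partialDeriv f₁ j.castSucc z = partialDeriv f j.castSucc z - partialDeriv g j (Fin.init z) := by
    intro z hz j
    simp only [partialDeriv]
    rw [(hDf1 z hz).fderiv]
    simp
  have hM1 : ∀ z ∈ S₁, |partialDeriv f₁ L z| ≤ M := fun z hz => by rw [hpd1L z hz]; exact hM z (hS₁S hz)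
  have hest1 : ∀ x ∈ G₁, ∀ t ∈ Ioo 0 η, |f₁ (Fin.snoc x t)| ≤ M * t := fun x hx t ht => by
    simp only [hf₁, Fin.init_snoc]; exact hg_est x (hG₁G hx) t ht
  have hf1_lim0 : ∀ x ∈ G₁, Tendsto (fun t => f₁ (Fin.snoc x t)) (𝓝[>] 0) (𝓝 0) := by
    intro x hx
    have h := (hg_lim x (hG₁G hx)).sub_const (g x)
    simp only [sub_self] at h
    simpa [hf₁] using h
  -- Step 4: the partial derivatives of `f₁`
  have hpd_sa : ∀ i, IsSemialgebraicFunOn ℝ S₁ (partialDeriv f₁ i) := fun i =>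
    isSemialgebraicFunOn_partialDeriv hS₁o hS₁sa hf1s hd1 i
  have hfder_cont : ContinuousOn (fun z => fderiv ℝ f₁ z) S₁ := hf1.continuousOn_fderiv_of_isOpen hS₁o le_rfl
  have hpd_cont : ∀ i, ContinuousOn (partialDeriv f₁ i) S₁ := fun i => hfder_cont.clm_apply continuousOn_const
  -- Step 5: the normal derivative has a limit off a small set
  obtain ⟨ZL, lam, hZLsa, hZLcl, hZLsm, hlam_cont, hlam_lim⟩ :=
    exists_limit_off_small hG₁o hG₁sa hη (hpd_cont L) (hpd_sa L) hM1
  -- Step 6: the tangential derivatives tend to `0` off small sets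
  have htang : ∀ j : Fin m, ∃ Zj : Set (Fin m → ℝ), IsSemialgebraic ℝ Zj ∧ IsSmall Zj ∧
      ∀ a ∈ G₁, a ∉ closure Zj → Tendsto (partialDeriv f₁ j.castSucc) (𝓝[S₁] (Fin.snoc a 0)) (𝓝 0) := by
    intro j
    obtain ⟨Zj, hZjsa, hZjsm, hbad⟩ := exists_small_of_two_clusterValues hG₁o hG₁sa (hpd_cont j.castSucc) (hpd_sa j.castSucc)
    refine ⟨Zj, hZjsa, hZjsm, fun a ha haZ => ?_⟩
    have h0 := zero_mem_clusterSet_tangential hG₁o hη hd1 hest1 j ha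
    obtain ⟨δ₀, hδ₀, hball⟩ := Metric.isOpen_iff.1 hG₁o a ha
    refine tendsto_of_clusterSet_subset (hpd_cont j.castSucc) hδ₀ (fun δ _ hδle => convex_halfBox_inter_ball hball hδle) h0
      fun v hv => ?_
    by_contra hne
    exact haZ (subset_closure (hbad ⟨ha, v, hv, 0, h0, hne⟩))
  choose Zt hZt_sa hZt_sm hZt_lim using htang
  -- Step 7: the exceptional set
  set Z := Z₁ ∪ (ZL ∪ ⋃ j ∈ (Finset.univ : Finset (Fin m)), closure (Zt j)) with hZ
  have hZsa : IsSemialgebraic ℝ Z :=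
    hZ₁sa.union (hZLsa.union (IsSemialgebraic.biUnion _ _ fun j _ => isSemialgebraic_closure (hZt_sa j)))
  have hZcl : IsClosed Z := hZ₁cl.union (hZLcl.union (isClosed_biUnion_finset fun j _ => isClosed_closure))
  have hZsm : IsSmall Z := by
    refine hZ₁sm.union ((show IsSmall ZL from hZLsm).union ?_ hZLsa
      (IsSemialgebraic.biUnion _ _ fun j _ => isSemialgebraic_closure (hZt_sa j)))
      hZ₁sa (hZLsa.union (IsSemialgebraic.biUnion _ _ fun j _ => isSemialgebraic_closure (hZt_sa j)))
    exact isSmall_biUnion _ (fun j _ => (hZt_sm j).closure (hZt_sa j)) fun j _ => isSemialgebraic_closure (hZt_sa j)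
  set G' := G \ Z with hG'
  have hG'o : IsOpen G' := hG.sdiff hZcl
  have hG'G₁ : G' ⊆ G₁ := fun a ha => ⟨ha.1, fun h => ha.2 (Or.inl h)⟩
  have hG'ZL : ∀ a ∈ G', a ∈ G₁ \ ZL := fun a ha => ⟨hG'G₁ ha, fun h => ha.2 (Or.inr (Or.inl h))⟩
  have hG'Zt : ∀ a ∈ G', ∀ j, a ∉ closure (Zt j) := fun a ha j h =>
    ha.2 (Or.inr (Or.inr (mem_iUnion₂.2 ⟨j, Finset.mem_univ _, h⟩)))
  -- Step 8: the derivative of `f₁` converges at bottom points of `G'`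
  set Lbot : (Fin m → ℝ) → (Fin (m + 1) → ℝ) →L[ℝ] ℝ := fun a => lam a • projL m with hLbot
  have hfder_lim : ∀ a ∈ G', Tendsto (fun w => fderiv ℝ f₁ w) (𝓝[S₁] (Fin.snoc a 0)) (𝓝 (Lbot a)) := by
    intro a ha
    refine tendsto_clm_of_tendsto_apply_single fun i => ?_
    refine Fin.lastCases ?_ (fun j => ?_) i
    · have h := hlam_lim a (hG'ZL a ha)
      have hB : (Lbot a) (Pi.single (Fin.last m) 1) = lam a := by simp [hLbot]
      rw [hB]; exact h
    · have h := hZt_lim j a (hG'G₁ ha) (hG'Zt a ha j)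
      have h0 : (Lbot a) (Pi.single j.castSucc 1) = 0 := by
        simp [hLbot, (Fin.castSucc_lt_last j).ne]
      rw [h0]; exact h
  -- Step 9: the extension `F₁` of `f₁` by `0`, on `T = G' × [0, η)`
  set F₁ : (Fin (m + 1) → ℝ) → ℝ := fun z => if 0 < z L then f₁ z else 0 with hF₁
  set T := closedHalfBox G' η with hT
  have hTG₁ : ∀ z ∈ T, (Fin.init z : Fin m → ℝ) ∈ G₁ := fun z hz => hG'G₁ hz.1
  have hpos_open : IsOpen {z : Fin (m + 1) → ℝ | 0 < z L} := isOpen_lt continuous_const (continuous_apply L)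
  have hF₁f₁ : ∀ z : Fin (m + 1) → ℝ, 0 < z L → F₁ =ᶠ[𝓝 z] f₁ := fun z hz => by
    filter_upwards [hpos_open.mem_nhds hz] with w hw
    simp only [hF₁, if_pos (show 0 < w L from hw)]
  -- (9a) interior points
  have hderPos : ∀ z ∈ T, 0 < z L → HasFDerivAt F₁ (fderiv ℝ f₁ z) z := by
    intro z hz hzL
    have hzS₁ : z ∈ S₁ := ⟨hTG₁ z hz, hzL, hz.2.2⟩
    exact (((hd1 z hzS₁).differentiableAt (hS₁o.mem_nhds hzS₁)).hasFDerivAt).congr_of_eventuallyEq (hF₁f₁ z hzL)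
  -- the uniform estimate `|f₁ w| ≤ M · w_L` on `S₁`
  have hest1' : ∀ w ∈ S₁, |f₁ w| ≤ M * w L := by
    intro w hw
    have h := hest1 (Fin.init w) hw.1 (w L) ⟨hw.2.1, hw.2.2⟩
    rwa [Fin.snoc_init_self] at h
  -- (9b) bottom points
  have hderBot : ∀ a ∈ G', HasFDerivWithinAt F₁ (Lbot a) T (Fin.snoc a 0) := by
    intro a ha
    obtain ⟨δ₀, hδ₀, hballG'⟩ := Metric.isOpen_iff.1 hG'o a ha
    have hballG₁ : ball a δ₀ ⊆ G₁ := fun x hx => hG'G₁ (hballG' hx)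
    set δ := min (δ₀ / 2) (η / 2) with hδ
    have hδpos : 0 < δ := lt_min (half_pos hδ₀) (half_pos hη)
    have hδδ₀ : δ ≤ δ₀ := (min_le_left _ _).trans (half_le_self hδ₀.le)
    have hδη : δ < η := (min_le_right _ _).trans_lt (half_lt_self hη)
    have hcballG' : closedBall a δ ⊆ G' := fun x hx =>
      hballG' (mem_ball.2 ((mem_closedBall.1 hx).trans_lt ((min_le_left _ _).trans_lt (half_lt_self hδ₀))))
    set s := S₁ ∩ ball (Fin.snoc a 0 : Fin (m + 1) → ℝ) δ with hs
    have hso : IsOpen s := hS₁o.inter isOpen_ball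
    have hsconv : Convex ℝ s := convex_halfBox_inter_ball hballG₁ hδδ₀
    have hsS₁ : s ⊆ S₁ := inter_subset_left
    -- closure points: base in `closedBall a δ`, height in `[0, δ]`
    have hcl : ∀ y ∈ closure s, (Fin.init y : Fin m → ℝ) ∈ closedBall a δ ∧ 0 ≤ y L ∧ y L ≤ δ := by
      intro y hy
      have h1 : closure s ⊆ closedBall (Fin.snoc a 0 : Fin (m + 1) → ℝ) δ :=
        closure_minimal (inter_subset_right.trans ball_subset_closedBall) isClosed_closedBall
      have h2 : closure s ⊆ {z | 0 ≤ z L} :=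
        closure_minimal (fun z hz => (hz.1.2.1).le) (isClosed_le continuous_const (continuous_apply L))
      have hy1 := h1 hy
      rw [← Fin.snoc_init_self y, mem_closedBall, dist_snoc_snoc_max, max_le_iff] at hy1
      refine ⟨mem_closedBall.2 hy1.1, h2 hy, ?_⟩
      have := hy1.2; rw [Real.dist_eq, sub_zero] at this
      exact (le_abs_self _).trans this
    have hfdiff : DifferentiableOn ℝ F₁ s := fun w hw =>
      (hderPos w ⟨hballG' (by
        have := (mem_ball.1 hw.2); rw [← Fin.snoc_init_self w, dist_snoc_snoc_max, max_lt_iff] at this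
        exact mem_ball.2 (this.1.trans_le hδδ₀)), hw.1.2.1.le, hw.1.2.2⟩ hw.1.2.1).differentiableAt.differentiableWithinAt
    have hfcont : ∀ y ∈ closure s, ContinuousWithinAt F₁ s y := by
      intro y hy
      obtain ⟨hyB, hy0, hyδ⟩ := hcl y hy
      rcases eq_or_lt_of_le hy0 with hyL | hyL
      · -- bottom point: `F₁ → 0 = F₁ y`
        have hFy : F₁ y = 0 := by simp only [hF₁, ← hyL, lt_irrefl, if_false]
        rw [ContinuousWithinAt, hFy]
        have hbound : ∀ w ∈ s, |F₁ w| ≤ M * w L := fun w hw => by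
          simp only [hF₁, if_pos (show 0 < w L from hw.1.2.1)]; exact hest1' w (hsS₁ hw)
        have hL0 : Tendsto (fun w : Fin (m + 1) → ℝ => M * w L) (𝓝[s] y) (𝓝 0) := by
          have h : Tendsto (fun w : Fin (m + 1) → ℝ => M * w L) (𝓝 y) (𝓝 (M * y L)) :=
            (continuous_const.mul (continuous_apply L)).tendsto y
          rw [← hyL, mul_zero] at h
          exact h.mono_left nhdsWithin_le_nhds
        refine squeeze_zero_norm' ?_ hL0
        filter_upwards [self_mem_nhdsWithin] with w hw
        rw [Real.norm_eq_abs]; exact hbound w hw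
      · -- interior point
        have hyS₁ : y ∈ S₁ := ⟨hG'G₁ (hcballG' hyB), hyL, hyδ.trans_lt hδη⟩
        exact ((hderPos y ⟨hcballG' hyB, hy0, hyδ.trans_lt hδη⟩ hyL).continuousAt).continuousWithinAt
    have hflim : Tendsto (fun w => fderiv ℝ F₁ w) (𝓝[s] (Fin.snoc a 0)) (𝓝 (Lbot a)) := by
      have h := (hfder_lim a ha).mono_left (nhdsWithin_mono _ hsS₁)
      refine h.congr' ?_
      filter_upwards [self_mem_nhdsWithin] with w hw
      exact ((hderPos w ⟨hballG' (by
        have := (mem_ball.1 hw.2); rw [← Fin.snoc_init_self w, dist_snoc_snoc_max, max_lt_iff] at this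
        exact mem_ball.2 (this.1.trans_le hδδ₀)), hw.1.2.1.le, hw.1.2.2⟩ hw.1.2.1).fderiv).symm
    have hcl_der := hasFDerivWithinAt_closure_of_tendsto_fderiv hfdiff hsconv hso hfcont hflim
    -- `closure s` is a neighbourhood of `snoc a 0` within `T`
    refine hcl_der.mono_of_mem_nhdsWithin ?_
    refine mem_nhdsWithin.2 ⟨ball (Fin.snoc a 0) δ, isOpen_ball, mem_ball_self hδpos, ?_⟩
    rintro z ⟨hzball, hzT⟩
    have hzb : (Fin.init z : Fin m → ℝ) ∈ ball a δ ∧ |z L| < δ := by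
      have := mem_ball.1 hzball
      rw [← Fin.snoc_init_self z, dist_snoc_snoc_max, max_lt_iff] at this
      exact ⟨mem_ball.2 this.1, by simpa [Real.dist_eq] using this.2⟩
    rcases eq_or_lt_of_le hzT.2.1 with hzL | hzL
    · -- a bottom point is a limit of points of `s`
      rw [Metric.mem_closure_iff]
      intro ε hε
      set τ := min (ε / 2) (δ / 2) with hτ
      have hτpos : 0 < τ := lt_min (half_pos hε) (half_pos hδpos)
      refine ⟨Fin.snoc (Fin.init z) τ, ⟨snoc_mem_halfBox.2 ⟨hballG₁ (mem_ball.2 ((mem_ball.1 hzb.1).trans_le hδδ₀)), hτpos,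
        ((min_le_right _ _).trans_lt (half_lt_self hδpos)).trans hδη⟩, ?_⟩, ?_⟩
      · rw [mem_ball, dist_snoc_snoc_max]
        exact max_lt (mem_ball.1 hzb.1) (by rw [Real.dist_eq, sub_zero, abs_of_pos hτpos]; exact (min_le_right _ _).trans_lt (half_lt_self hδpos))
      · have hzeq : dist z (Fin.snoc (Fin.init z) τ) = dist (Fin.snoc (Fin.init z) (z L) : Fin (m + 1) → ℝ) (Fin.snoc (Fin.init z) τ) := by
          rw [hLdef, Fin.snoc_init_self]
        rw [hzeq, dist_snoc_snoc_max, dist_self, ← hzL, Real.dist_eq, zero_sub, abs_neg, abs_of_pos hτpos,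
          max_eq_right hτpos.le]
        exact (min_le_left _ _).trans_lt (half_lt_self hε)
    · exact subset_closure ⟨⟨hG'G₁ hzT.1, hzL, hzT.2.2⟩, hzball⟩
  -- (9c) the derivative field and (9d) its continuity
  set Lf : (Fin (m + 1) → ℝ) → (Fin (m + 1) → ℝ) →L[ℝ] ℝ := fun z => if 0 < z L then fderiv ℝ f₁ z else Lbot (Fin.init z) with hLf
  have hderT : ∀ z ∈ T, HasFDerivWithinAt F₁ (Lf z) T z := by
    intro z hz
    rcases eq_or_lt_of_le hz.2.1 with hzL | hzL
    · have hz' : z = Fin.snoc (Fin.init z) 0 := eq_snoc_init_of_last_eq_zero hzL.symm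
      have hLfz : Lf z = Lbot (Fin.init z) := by
        show (if 0 < z L then fderiv ℝ f₁ z else Lbot (Fin.init z)) = Lbot (Fin.init z)
        rw [if_neg (by rw [← hzL]; exact lt_irrefl 0)]
      rw [hLfz]
      have h := hderBot (Fin.init z) hz.1
      rwa [← hz'] at h
    · have hLfz : Lf z = fderiv ℝ f₁ z := by
        show (if 0 < z L then fderiv ℝ f₁ z else Lbot (Fin.init z)) = fderiv ℝ f₁ z
        rw [if_pos hzL]
      rw [hLfz]; exact (hderPos z hz hzL).hasFDerivWithinAt
  have hLf_cont : ContinuousOn Lf T := by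
    intro z hz
    rcases eq_or_lt_of_le hz.2.1 with hzL | hzL
    · -- bottom point `z = snoc a 0`
      set a := Fin.init z with ha_def
      have ha : a ∈ G' := hz.1
      have hz' : z = Fin.snoc a 0 := eq_snoc_init_of_last_eq_zero hzL.symm
      have hLfz : Lf z = Lbot a := by
        show (if 0 < z L then fderiv ℝ f₁ z else Lbot (Fin.init z)) = Lbot a
        rw [if_neg (by rw [← hzL]; exact lt_irrefl 0)]
      rw [ContinuousWithinAt, hLfz]
      -- split `T` into its open part (inside `S₁`) and its bottom
      have hTsplit : T ⊆ (T ∩ {w | 0 < w L}) ∪ (T ∩ {w | w L = 0}) := by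
        intro w hw
        rcases eq_or_lt_of_le hw.2.1 with h | h
        · exact Or.inr ⟨hw, h.symm⟩
        · exact Or.inl ⟨hw, h⟩
      refine Tendsto.mono_left ?_ (nhdsWithin_mono _ hTsplit)
      rw [nhdsWithin_union]
      refine Tendsto.sup ?_ ?_
      · -- open part: `Lf = fderiv f₁ → Lbot a`
        have h1 : Tendsto (fun w => fderiv ℝ f₁ w) (𝓝[T ∩ {w | 0 < w L}] z) (𝓝 (Lbot a)) := by
          rw [hz']
          exact (hfder_lim a ha).mono_left (nhdsWithin_mono _ fun w hw => ⟨hTG₁ w hw.1, hw.2, hw.1.2.2⟩)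
        refine h1.congr' ?_
        filter_upwards [self_mem_nhdsWithin] with w hw
        show fderiv ℝ f₁ w = (if 0 < w L then fderiv ℝ f₁ w else Lbot (Fin.init w))
        rw [if_pos (show 0 < w L from hw.2)]
      · -- bottom part: `Lf w = Lbot (init w)`, continuity of `lam`
        have hlam : ContinuousWithinAt (fun w : Fin (m + 1) → ℝ => lam (Fin.init w)) (T ∩ {w | w L = 0}) z := by
          have hc : ContinuousWithinAt lam (G₁ \ ZL) a := hlam_cont a (hG'ZL a ha)
          have hinit : ContinuousWithinAt (fun w : Fin (m + 1) → ℝ => (Fin.init w : Fin m → ℝ)) (T ∩ {w | w L = 0}) z :=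
            (continuous_pi fun i => continuous_apply _).continuousWithinAt
          have hmaps : MapsTo (fun w : Fin (m + 1) → ℝ => (Fin.init w : Fin m → ℝ)) (T ∩ {w | w L = 0}) (G₁ \ ZL) :=
            fun w hw => hG'ZL _ hw.1.1
          exact hc.comp hinit hmaps
        have h2 : Tendsto (fun w : Fin (m + 1) → ℝ => lam (Fin.init w) • projL m) (𝓝[T ∩ {w | w L = 0}] z)
            (𝓝 (lam a • projL m)) := hlam.tendsto.smul_const _
        refine h2.congr' ?_
        filter_upwards [self_mem_nhdsWithin] with w hw
        show lam (Fin.init w) • projL m = (if 0 < w L then fderiv ℝ f₁ w else Lbot (Fin.init w))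
        rw [if_neg (by rw [show w L = 0 from hw.2]; exact lt_irrefl 0)]
    · -- interior point: `Lf = fderiv f₁` near `z`, continuous
      have hzS₁ : z ∈ S₁ := ⟨hTG₁ z hz, hzL, hz.2.2⟩
      have hc : ContinuousAt (fun w => fderiv ℝ f₁ w) z := (hfder_cont z hzS₁).continuousAt (hS₁o.mem_nhds hzS₁)
      have heq : Lf =ᶠ[𝓝 z] fun w => fderiv ℝ f₁ w := by
        filter_upwards [hpos_open.mem_nhds hzL] with w hw
        show (if 0 < w L then fderiv ℝ f₁ w else Lbot (Fin.init w)) = fderiv ℝ f₁ w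
        rw [if_pos (show 0 < w L from hw)]
      exact (hc.congr_of_eventuallyEq heq |>.continuousWithinAt)
  -- (9e)-(9f): `F₁` is `C¹` on `T`
  have hTuniq : UniqueDiffOn ℝ T := uniqueDiffOn_closedHalfBox hG'o hη
  have hF₁diff : DifferentiableOn ℝ F₁ T := fun z hz => (hderT z hz).differentiableWithinAt
  have hF₁fdw : ∀ z ∈ T, fderivWithin ℝ F₁ T z = Lf z := fun z hz => (hderT z hz).fderivWithin (hTuniq z hz)
  have hF₁C1 : ContDiffOn ℝ 1 F₁ T := by
    rw [show (1 : WithTop ℕ∞) = 0 + 1 from rfl, contDiffOn_succ_iff_fderivWithin hTuniq]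
    refine ⟨hF₁diff, fun h => absurd h (by simp), ?_⟩
    rw [contDiffOn_zero]
    exact hLf_cont.congr fun z hz => hF₁fdw z hz
  -- Step 10: add back `g ∘ init`
  have hTsub : T ⊆ {z : Fin (m + 1) → ℝ | (Fin.init z : Fin m → ℝ) ∈ G₁} := fun z hz => hTG₁ z hz
  have hbd : ∀ z, bdExt f g z = F₁ z + g (Fin.init z) := by
    intro z
    simp only [bdExt, hF₁, hf₁]
    split_ifs <;> ring
  have hbd' : bdExt f g = fun z => F₁ z + g (Fin.init z) := funext hbd
  refine ⟨Z, g, lam, hZsa, hZcl, hZsm, hg_sa, hg1.mono fun a ha => hG'G₁ ha, hlam_cont.mono fun a ha => hG'ZL a ha,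
    fun a ha => ?_, fun a ha => ?_, ?_, fun a ha => ?_⟩
  · -- continuity of `f` up to `g` at bottom points of `G'`
    have haG₁ : a ∈ G₁ := hG'G₁ ha
    rw [← nhdsWithin_halfBox_eq hG₁o hG₁G haG₁ 0]
    have h1 : Tendsto f₁ (𝓝[S₁] (Fin.snoc a 0)) (𝓝 0) := by
      have hL0 : Tendsto (fun w : Fin (m + 1) → ℝ => M * w L) (𝓝[S₁] (Fin.snoc a 0)) (𝓝 0) := by
        have hc : Continuous fun w : Fin (m + 1) → ℝ => M * w L := continuous_const.mul (continuous_apply L)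
        have h : Tendsto (fun w : Fin (m + 1) → ℝ => M * w L) (𝓝 (Fin.snoc a 0 : Fin (m + 1) → ℝ))
            (𝓝 (M * (Fin.snoc a 0 : Fin (m + 1) → ℝ) L)) := hc.tendsto _
        rw [show (Fin.snoc a 0 : Fin (m + 1) → ℝ) L = 0 by simp [hLdef], mul_zero] at h
        exact h.mono_left nhdsWithin_le_nhds
      refine squeeze_zero_norm' ?_ hL0
      filter_upwards [self_mem_nhdsWithin] with w hw
      rw [Real.norm_eq_abs]; exact hest1' w hw
    have h2 : Tendsto (fun w : Fin (m + 1) → ℝ => g (Fin.init w)) (𝓝[S₁] (Fin.snoc a 0)) (𝓝 (g a)) := by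
      have hc : ContinuousAt (fun w : Fin (m + 1) → ℝ => g (Fin.init w)) (Fin.snoc a 0) :=
        (hDginit _ (by simpa using haG₁)).continuousAt
      have := hc.tendsto
      simp only [Fin.init_snoc] at this
      exact this.mono_left nhdsWithin_le_nhds
    have h := h1.add h2
    simp only [zero_add] at h
    refine h.congr' (Eventually.of_forall fun w => ?_)
    simp [hf₁]
  · -- the normal derivative
    have haG₁ : a ∈ G₁ := hG'G₁ ha
    rw [← nhdsWithin_halfBox_eq hG₁o hG₁G haG₁ 0]
    refine (hlam_lim a (hG'ZL a ha)).congr' ?_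
    filter_upwards [self_mem_nhdsWithin] with w hw using hpd1L w hw
  · -- `C¹`
    rw [hbd']
    exact hF₁C1.add (hginit.mono hTsub)
  · -- the derivative at the bottom
    rw [hbd']
    have h1 := hderT (Fin.snoc a 0) (snoc_mem_closedHalfBox.2 ⟨ha, le_rfl, hη⟩)
    have hLf0 : Lf (Fin.snoc a 0) = Lbot a := by
      show (if 0 < (Fin.snoc a 0 : Fin (m + 1) → ℝ) L then fderiv ℝ f₁ (Fin.snoc a 0) else Lbot (Fin.init (Fin.snoc a 0 : Fin (m + 1) → ℝ))) = Lbot a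
      rw [if_neg (by simp [hLdef])]
      simp
    rw [hLf0] at h1
    have h2 : HasFDerivAt (fun z : Fin (m + 1) → ℝ => g (Fin.init z))
        (fderiv ℝ (fun z : Fin (m + 1) → ℝ => g (Fin.init z)) (Fin.snoc a 0)) (Fin.snoc a 0) :=
      (hDginit _ (by simpa using hG'G₁ ha)).differentiableAt.hasFDerivAt
    exact (h1.add h2.hasFDerivWithinAt).congr_fderiv (add_comm _ _)

end Boundary

end Literature.ModelTheory.ExponentialFields
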